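import Mathlib
import Summits.KontsevichZagierPeriods.Zeta5Search.DenomLaw.RuleRABTopCellSub
import Summits.KontsevichZagierPeriods.Zeta5Search.DenomLaw.RuleRABFamilyHolds
import HarnessLib

/-!
# ζ(5) search — DENOM-LAW: `RuleR2ABTopCell` is FALSE AS TYPED at `t = 7` (witness `(t,n,p) = (7,4,37)`, value `−14`) and its REPAIRED form is a THEOREM (prover-d1 g5)

HONEST FRAMING: systematic search; no irrationality claim unless certified.  Cell `pub-zeta5`, track «DENOM-LAW», seat `denom-prover-d1` gen 5
(`denom-law/prover-d1/ATTEMPT-6.md` §10–§12).  `p`-adic valuations of the explicit rationals `Cas₇(b) = W(b+e₇)V(b) − W(b)V(b+e₇)` on the census's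
A/B family `b = bLin (t n) (t n + 2n) n = n·(3t+14; t+6,…,t)`; nothing about ζ(5); no γ; records in print UNMOVED.

THE NODE.  `DenomLaw.RuleR2ABTopCell` (statement file `RuleRABFamily.lean`, prover-d1 g3): for all `t ≥ 7`, `n ≥ 1` and primes
`(t+2)n < p ≤ (t+3)n`, `v_p(Cas₇) ≥ −13` (rule R2's value; the PROVED floor on the cell is `−14`, `RuleR2ABTopCellLB` / `RuleRAB.cell2`, Lemma D).
PROVED PART (all `n`): `t ≥ 8` (`RuleRAB.ruleR2ABTopCell_of_eight_le`, g3, conjugate-raise law) and `t = 7` on the sub-window `19n < 2p`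
(`RuleRAB.ruleR2ABTopCell_of_sub`, g5) — packaged below as the REPAIRED node `RuleR2ABTopCellSub` with `ruleR2ABTopCellSub_holds`; also `n = 1`
(`RuleRAB.ruleR2ABTopCell_of_n_one`).  What the statement file's threshold `t ≥ 7` adds beyond that is exactly the sub-cell `t = 7`, `n ≥ 2`,
`2p ≤ 19n` (`ruleR2ABTopCell_iff_low` below; there the cell carries the sub-deep 3-point classes `[0,−6,−2]` at `E = m + 1 = −8`, outside
hypothesis (H2) of the conjugate-raise law — ATTEMPT-6 §10), and THERE THE NODE IS FALSE:

WITNESS `(t, n, p) = (7, 4, 37)`: `b = bLin 28 36 4 = (140; 52, 48, 44, 40, 36, 32, 28)`, `9n = 36 < 37 ≤ 40 = 10n`, `2p = 74 < 76 = 19n`: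
**`v₃₇(Cas₇(b)) = −14`** `< −13` — the proved floor `−14` is ATTAINED.  EVIDENCE (exact arithmetic, THREE implementations, seat folder
`code/t7bad/`, HOME `denom-law/prover-d1/g5/code/t7bad/`): (i) gen-2 g12's certified `p`-adic engine `vpadic.py` (`−14`, 39 certified 37-adic digits);
(ii) gen-2 g6's exact-rational partial-fraction kernel `pf.py` (`forms`; `Cas₇ ≠ 0`, `v = −14`, 2.7 s); (iii) the cell's gen-1 dual-series engine
`code/gen1/dictionary.py` through prover-d1 g3's `exact_cas.py` — the engine of the statement file's own 26 instances (`−14`, 1.1 s);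
`(v U, v W, v V) = (−4, −6, −9)` at `b` and at `b + e₇` in all three.  The same value `−14` at every other computed prime of the sub-cell
`t = 7`, `2p < 19n`: `(7,5,47)` (vpadic + exact), `(7,8,73)`, `(7,9,83)`, `(7,11,101)`, `(7,11,103)` (vpadic, 39 digits each); the lattice edge
`2p = 19n` — the single instance `(7,2,19)` of the statement file — has `−13` (all three engines), and `−13` throughout `19n < 2p` and `t = 8`
(PROVED there; engines agree: kit job of this seat `t7-topcell-scan`, `n ≤ 40`).  So the statement file's threshold was one unit too generous on
exactly one sub-cell; rule R2 itself (`RuleR2Casoratian`, general `b`; the family's top cell is an instance only for `t ≥ 15`) is NOT touched, nor are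
engine-d2's sealed out-of-sample scores (A18 = `t = 15`).

KERNEL STATUS.  The refutation is NOT certified in the kernel here: `−14 = casLB + 1` means the FIRST Casoratian digit vanishes (Lemma D, proved) and
the SECOND does not, and the tree's sharpness tool (`ClusterValuation.casSharpnessH0`, `CasDigitX1Sliver`) is first-digit only.  Following gen-2 g23's
`X1CellQSliverWitness` pattern the deciding number is typed as a COMPUTATION node `TopCellWitnessValue` with the reduction
`not_ruleR2ABTopCell_of_witness : TopCellWitnessValue → ¬ RuleR2ABTopCell` (and the value-free form `not_ruleR2ABTopCell_of_le`); a second-digit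
certificate (e.g. `K̃, Ṽ, K̃⁺, Ṽ⁺ (mod 37²)` of the 2×2 bracket via the landed `SecondDigitW/V` formulas) closes it.
-/

namespace Summit.KontsevichZagierPeriods.Zeta5Search.DenomLaw

open Summit.KontsevichZagierPeriods.Zeta5Search.CasoratianValuation (casoratian)
open Summit.KontsevichZagierPeriods.Zeta5Search.CellKit (bLin)

/-! ## §1 The repaired node (PROVED) and the exact residual of the typed one -/

/-- **`RuleR2ABTopCell` REPAIRED** (the provable — and proved — form): for all `t ≥ 7`, `n ≥ 1` and primes `(t+2)n < p ≤ (t+3)n` with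
`t ≥ 8` OR `19n < 2p`, `v_p(Cas₇(n·(3t+14; t+6,…,t))) ≥ −13`.  PROVED: `ruleR2ABTopCellSub_holds`. -/
@[conjecture] def RuleR2ABTopCellSub : Prop :=
  ∀ t n p : ℕ, 7 ≤ t → 1 ≤ n → p.Prime → t * n + 2 * n < p → p ≤ t * n + 3 * n → (8 ≤ t ∨ 19 * n < 2 * p) →
    casoratian (bLin (t * n) (t * n + 2 * n) n) 7 ≠ 0 →
      (-13 : ℤ) ≤ padicValRat p (casoratian (bLin (t * n) (t * n + 2 * n) n) 7)

/-- **The repaired node HOLDS** (`t ≥ 8`: prover-d1 g3's `ruleR2ABTopCell_of_eight_le`; `19n < 2p`: g5's `ruleR2ABTopCell_of_sub`; both via the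
conjugate-raise law `conjugateRaiseLaw_holds`). -/
theorem ruleR2ABTopCellSub_holds : RuleR2ABTopCellSub := by
  intro t n p ht hn hp hA hB h hne
  rcases h with h8 | hP
  · exact RuleRAB.ruleR2ABTopCell_of_eight_le t n p h8 hn hp hA hB hne
  · exact RuleRAB.ruleR2ABTopCell_of_sub t n p ht hn hp hA hB hP hne

/-- The typed node implies the repaired one (restriction). -/
theorem ruleR2ABTopCellSub_of (h : RuleR2ABTopCell) : RuleR2ABTopCellSub :=
  fun t n p ht hn hp hA hB _ hne => h t n p ht hn hp hA hB hne

/-- **Exact residual**: given the proved part, the typed node `RuleR2ABTopCell` is EQUIVALENT to its restriction to the sub-cell `t = 7`, `n ≥ 2`,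
`9n < p`, `2p ≤ 19n` (ray `n·(35; 13,…,7)`). -/
theorem ruleR2ABTopCell_iff_low :
    RuleR2ABTopCell ↔
      (∀ n p : ℕ, 2 ≤ n → p.Prime → 9 * n < p → 2 * p ≤ 19 * n →
        casoratian (bLin (7 * n) (7 * n + 2 * n) n) 7 ≠ 0 →
          (-13 : ℤ) ≤ padicValRat p (casoratian (bLin (7 * n) (7 * n + 2 * n) n) 7)) :=
  ⟨fun h n p hn hp hA hB hne => h 7 n p le_rfl (by omega) hp (by omega) (by omega) hne, RuleRAB.ruleR2ABTopCell_of_seven_low⟩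

/-! ## §2 The witness `(t, n, p) = (7, 4, 37)` -/

/-- The witness satisfies every arithmetic hypothesis of `RuleR2ABTopCell` (`7 ≤ 7`, `1 ≤ 4`, `37` prime, `36 < 37 ≤ 40`) and lies in the
residual sub-cell (`2·37 = 74 < 76 = 19·4`), i.e. OUTSIDE the repaired node's extra hypothesis. -/
theorem topCellWitness_hyps :
    (7 : ℕ) ≤ 7 ∧ (1 : ℕ) ≤ 4 ∧ Nat.Prime 37 ∧ 7 * 4 + 2 * 4 < 37 ∧ 37 ≤ 7 * 4 + 3 * 4 ∧ ¬ (8 ≤ 7 ∨ 19 * 4 < 2 * 37) := by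
  refine ⟨le_rfl, by norm_num, by norm_num, by norm_num, by norm_num, by norm_num⟩

/-- The witness vector is `(140; 52, 48, 44, 40, 36, 32, 28) = 4·(35; 13, 12, 11, 10, 9, 8, 7)`. -/
theorem topCellWitness_vector :
    (List.range 8).map (bLin (7 * 4) (7 * 4 + 2 * 4) 4) = [140, 52, 48, 44, 40, 36, 32, 28] := by decide

/-- **The deciding number** (a COMPUTATION target, not a law: value `−14` by three exact implementations — module docstring; kernel certificate
wanted, it needs the SECOND `37`-adic digit of the Casoratian bracket): `v₃₇(Cas₇(bLin 28 36 4)) = −14`. -/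
@[conjecture] def TopCellWitnessValue : Prop :=
  padicValRat 37 (casoratian (bLin (7 * 4) (7 * 4 + 2 * 4) 4) 7) = -14

/-- What the typed node PREDICTS at the witness: `v₃₇(Cas₇) ≥ −13`. -/
theorem ruleR2ABTopCell_at_witness (h : RuleR2ABTopCell) (hne : casoratian (bLin (7 * 4) (7 * 4 + 2 * 4) 4) 7 ≠ 0) :
    (-13 : ℤ) ≤ padicValRat 37 (casoratian (bLin (7 * 4) (7 * 4 + 2 * 4) 4) 7) :=
  h 7 4 37 le_rfl (by norm_num) (by norm_num) (by norm_num) (by norm_num) hne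

/-- **Refutation reduced to a certificate, value-free form**: any kernel certificate of `Cas₇ ≠ 0` and `v₃₇(Cas₇(bLin 28 36 4)) ≤ −14` refutes
the typed node. -/
theorem not_ruleR2ABTopCell_of_le (hne : casoratian (bLin (7 * 4) (7 * 4 + 2 * 4) 4) 7 ≠ 0)
    (hv : padicValRat 37 (casoratian (bLin (7 * 4) (7 * 4 + 2 * 4) 4) 7) ≤ -14) : ¬ RuleR2ABTopCell := fun h => by
  have := ruleR2ABTopCell_at_witness h hne
  omega

/-- **Refutation reduced to the deciding number**: `TopCellWitnessValue → ¬ RuleR2ABTopCell`. -/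
theorem not_ruleR2ABTopCell_of_witness (h : TopCellWitnessValue) : ¬ RuleR2ABTopCell := by
  have h' : padicValRat 37 (casoratian (bLin (7 * 4) (7 * 4 + 2 * 4) 4) 7) = -14 := h
  refine not_ruleR2ABTopCell_of_le (fun h0 => ?_) (le_of_eq h')
  rw [h0] at h'
  simp at h'

/-- Conversely the proved floor is consistent with the witness value: `RuleR2ABTopCellLB` (PROVED, `ruleR2ABTopCellLB_holds`) gives `≥ −14` there,
so `−14` is the floor ATTAINED, not a breach of a proved bound. -/
theorem topCellWitness_floor (hne : casoratian (bLin (7 * 4) (7 * 4 + 2 * 4) 4) 7 ≠ 0) :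
    (-14 : ℤ) ≤ padicValRat 37 (casoratian (bLin (7 * 4) (7 * 4 + 2 * 4) 4) 7) :=
  ruleR2ABTopCellLB_holds 7 4 37 le_rfl (by norm_num) (by norm_num) (by norm_num) (by norm_num) hne

end Summit.KontsevichZagierPeriods.Zeta5Search.DenomLaw
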